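/-
Copyright: cell `pub-ymgap` (HUMAN RULING D-0062), Track A of `YM-PLAN.md`, DAG node N20 (= NE7b); R134 acceleration seat
`pub-ymgap-dag-n20-c` (strategy s1, generation 11), module 55.  Released under the licence of the surrounding project.
-/
import Summits.QuantumFields.YangMills.Theorems.BalabanUVNodesN20LCSNamedPropsOfAny
import Literature.MathematicalPhysics.QuantumFieldTheory.Balaban1983to89.B15Prop1DatumSmall7AtZSequence
import HarnessLib

/-!
# YM-DAG node N20 (= NE7b), row s1, module 55: (T♮)'s TOP-LAYER PREMISE IS PRINT'S (7) AT EVERY LAYER OF `𝐁_{j+1}(□^{∼4})` —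
# the instance and the named Props modulo (W♮) + (T♭), (T♭) = [15] Thm 1 (8) for the χ-problems of record WITH PRINT'S ALL-LAYER PREMISE

Track A of `YM-PLAN.md` (cell `pub-ymgap`, HUMAN RULING D-0062), node **N20** = spine estimate NE7b (`T4WeightBudget.RelWeightBound`, NOT PRINTED, NOT
PROVED).  Seat `pub-ymgap-dag-n20-c` (R134, s1), generation 11, module 55 (imports module 54 `…N20LCSNamedPropsOfAny` and dag-n12-c's
`Literature.….B15Prop1DatumSmall7AtZSequence`, whose §2∕§4∕§8 lemmas are cited BY NAME).

WHY.  Modules 48–54 display the row's instance modulo (W♮) + (T♮); (T♮) asks, at every χ_{j+1}-cube `c`, that every minimiser of def-R's (2.16) problem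
(class `{PlaqSmall (εreg·η_{j+1}²)}`, determining set `𝐁_{j+1}(□_c^{∼4}) = genSet (maxDomT M₁ □^{∼4}) (j+1)`, datum `M˙(Q_{j+1}^{s*}V')`) be `ε(g_{j+1})η²`-small on
`{p ⊂ □^∼}` as soon as `V'` is `ε″ = ε(g_{j+1})∕B`-small on the scale-`(j+1)` plaquettes SOURCED IN `□^{∼4}` — a TOP-LAYER premise, whereas print's hypothesis (7)
([15] p. 278) asks `|∂V(p′) − 1| < ε₁` on EVERY layer of the determining set.  g10 recorded this as an open interface point (HOME `N20-S1-RESIDUAL.md` §(T♮)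
CAUTION).  THIS MODULE CLOSES IT: the layer-`i` member of the datum is `M^i(Q_{j+1}^{s*}V') = Q^{s*}_{j+1−i}V'` (section property at NODE 00's averaging), a
plaquette variable of a pull-back is `1` or `V'(∂q̄)` with `q̄` inside `(□^{∼4})^{(j+1)}`, and `□_c^{∼4}` IS a union of `(j+1)`-blocks (§1, proved: side
`L^{j+2}M₂R_{j+1}`), so the top-layer premise IS print's (7) at every layer, on every plaquette inside `□^{∼4}` ⊇ print's range ([15] p. 279 (11) is this very
pull-back construction).  Hence the instance holds modulo (W♮) + (T♭), (T♭) = (T♮) with print's ALL-LAYER premise — a WEAKER hypothesis, = [15] Thm 1 (8) for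
the χ-problems of record with its premise RESTRICTED; the far field enters only through def-R's global class (solvability, module 46 §2), never through (7).

CONTENTS.  §1 `mem_Icc_iff_ediv`, ★ `isUnionOfCubes_preimage_cubeEnl`, ★ `isBlockUnion_cubeEnl`.  §2 ★★ `plaqSmallOn_layers_avgFamily_qsstarGIter0`, `pow_succ_dvd_sideχ`,
`isBlockUnion_cubeEnl_sideχ`, ★★ `plaqSmallOn_layers_datum_of_top`.  §3 ★★ `dataSmall7PTop_avgFamily_qsstarGIter0_cubeEnl` (letters: print's
`M₁ ≥ 2`, torus divisibility `L^{j+1}M₁ ∣ 2L^{m+K}`), ★ `…_supp`.  §4 ★★ `hThm1_of_allLayers` ((T♭) ⇒ (T♮)), `hThm1'_of_le_epsOfRecord` (A2: (T♭) degenerately inhabited when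
`εreg ≤ ε_{k+1}`), `epsOfRecord_div_pos`, ★★★ `sum_admS_integral_le_rec_pinnedLevels_of_le_gstar_allLayers` (module 53 modulo (W♮)+(T♭)), ★★★ `halves_of_le_gstar_of_any_allLayers`
(module 54 modulo (W♮)+(T♭)).  No `def`, no `instance`, no `sorry`; axioms standard.

HONEST FRAMING.  Count-neutral kernel work (a geometric bridge between the lineage's residual letter and print's (7)); (W♮) («LCS-j on the hull», (A1c)) untouched —
THE wall; (T♭)∕(T♮) NOT proved ([15] Thm 1 for def-R's χ-class local problems is K0∕def-R's); N20 NOT discharged; (α)-instance 0∕1; nothing continuum ∕ OS ∕ mass-gap ∕ Clay.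
-/

noncomputable section

open scoped BigOperators ENNReal

namespace Summit.QuantumFields.YangMills.BalabanUVNodes.N20LCSDatumAllLayers

open MeasureTheory
open Literature.MathematicalPhysics.QuantumFieldTheory.Balaban1983to89
open Literature.MathematicalPhysics.QuantumFieldTheory.Balaban1983to89.T4Continuum
open Literature.MathematicalPhysics.QuantumFieldTheory.Balaban1983to89.B14.Eq218Concrete
open Literature.MathematicalPhysics.QuantumFieldTheory.Balaban1983to89.Node00
open B15DeterminingSets B14.Eq213DetSet B14.Eq216Concrete B14.Eq213MaximalDomains B15Eq112TorusCover B14DomainGeom B15LatticeCubeTorus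
open B14.Eq22Determines (blockIter IsBlockUnion)
open B15Prop1Carrier (plaqsInside)
open Literature.MathematicalPhysics.QuantumFieldTheory.BalabanImbrieJaffe1984to88.BIJ85Eq453GaugeField (qsstarGIter0 qsstarGIter)
open ExpMeanLog (deltaSU)
open Summit.QuantumFields.BalabanUV.T4Continuum.B16HistoryIndexedRepr (GoodClass)
open Summit.QuantumFields.BalabanUV.T4Continuum.B16HistoryReprChain
open Summit.QuantumFields.BalabanUV.T4Continuum.NE7b.PrefixExtraction (admS)
open Summit.QuantumFields.BalabanUV.T4Continuum.NE7b.LocalConditionalStability (LocCondStability PointwiseExtraction)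
open Summit.QuantumFields.YangMills.BalabanUVNodes.N20LCSLabelTower
open Summit.QuantumFields.YangMills.BalabanUVNodes.N20LCSAvgDominationRegion (boxRegion)
open Summit.QuantumFields.YangMills.BalabanUVNodes.N20LCSSmallCouplingInstance (sum_admS_integral_le_rec_pinnedLevels_of_le_gstar)
open Summit.QuantumFields.YangMills.BalabanUVNodes.N20LCSNamedPropsOfAny (halves_of_le_gstar_of_any)

/-! ## §1  def-R's enlarged cubes `cubeEnl P s a w` are unions of `n`-blocks when `Lⁿ ∣ s` -/

section Geometry

variable {P : Params}

/-- An integer interval `[lo, hi]` with `t ∣ lo`, `t ∣ hi + 1` is a union of `t`-intervals: membership is read off the `t`-index `x ∕ t`. [folklore] -/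
theorem mem_Icc_iff_ediv {t : ℕ} (ht : 0 < t) {lo hi : ℤ} (hlo : (t : ℤ) ∣ lo) (hhi : (t : ℤ) ∣ hi + 1) (x : ℤ) :
    (lo ≤ x ∧ x ≤ hi) ↔ (lo / t ≤ x / t ∧ x / t < (hi + 1) / t) := by
  have ht' : (0 : ℤ) < t := by exact_mod_cast ht
  obtain ⟨a, ha⟩ := hlo
  obtain ⟨b, hb⟩ := hhi
  have h1 : lo / t = a := by rw [ha, Int.mul_ediv_cancel_left _ ht'.ne']
  have h2 : (hi + 1) / t = b := by rw [hb, Int.mul_ediv_cancel_left _ ht'.ne']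
  rw [h1, h2]
  constructor
  · rintro ⟨hl, hh⟩
    refine ⟨?_, ?_⟩
    · rw [Int.le_ediv_iff_mul_le ht']; linarith
    · rw [Int.ediv_lt_iff_lt_mul ht']; linarith
  · rintro ⟨hl, hh⟩
    rw [Int.le_ediv_iff_mul_le ht'] at hl
    rw [Int.ediv_lt_iff_lt_mul ht'] at hh
    exact ⟨by linarith, by linarith⟩

/-- **THE COVER PULL-BACK OF `cubeEnl P s a w` IS A UNION OF `t`-CUBES** when `t ∣ s` and `t ∣ 2L^{m+K}` (the torus period): it is the deck-saturation of the
box `cubeExt s a (w·s)`, whose faces are aligned to the `s`-partition.[cite: Balaban1988Convergent, (2.16)–(2.17) p.257; Balaban1987RG1, (0.1) p.251] -/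
theorem isUnionOfCubes_preimage_cubeEnl {t s : ℕ} (ht : 0 < t) (hts : t ∣ s) (htN : t ∣ P.sitesPerDir 0) (a : Pt P.d) (w : ℕ) :
    IsUnionOfCubes t (cover P ⁻¹' cubeEnl P s a w) := by
  have ht' : (0 : ℤ) < t := by exact_mod_cast ht
  obtain ⟨N', hN'⟩ := htN
  -- the aligned faces of the box
  have hlo : ∀ i, (t : ℤ) ∣ (s : ℤ) * a i - ((w * s : ℕ) : ℤ) := fun i => by
    obtain ⟨s', rfl⟩ := hts
    exact ⟨(s' : ℤ) * a i - (w * s' : ℕ), by push_cast; ring⟩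
  have hhi : ∀ i, (t : ℤ) ∣ (s : ℤ) * a i + s - 1 + ((w * s : ℕ) : ℤ) + 1 := fun i => by
    obtain ⟨s', rfl⟩ := hts
    exact ⟨(s' : ℤ) * a i + s' + (w * s' : ℕ), by push_cast; ring⟩
  -- membership read off the `t`-index
  have key : ∀ x : Pt P.d, x ∈ cover P ⁻¹' cubeEnl P s a w ↔
      ∃ v : Pt P.d, ∀ i, ((s : ℤ) * a i - ((w * s : ℕ) : ℤ)) / t ≤ cubeIdx t x i + (N' : ℤ) * v i ∧
        cubeIdx t x i + (N' : ℤ) * v i < ((s : ℤ) * a i + s - 1 + ((w * s : ℕ) : ℤ) + 1) / t := by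
    intro x
    have hshift : ∀ (v : Pt P.d) (i : Fin P.d), (x + pmul (per P) v) i / (t : ℤ) = cubeIdx t x i + (N' : ℤ) * v i := by
      intro v i
      show (x i + ((P.sitesPerDir 0 : ℕ) : ℤ) * v i) / (t : ℤ) = x i / (t : ℤ) + (N' : ℤ) * v i
      rw [hN', Nat.cast_mul, mul_assoc, Int.add_mul_ediv_left _ _ ht'.ne']
    constructor
    · rintro ⟨z, hz, hzx⟩
      obtain ⟨v, hv⟩ := (cover_eq_cover_iff z x).1 hzx
      refine ⟨-v, fun i => ?_⟩
      have hzi : z i = (x + pmul (per P) (-v)) i := by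
        rw [hv]
        show z i = z i + ((per P i : ℕ) : ℤ) * v i + ((per P i : ℕ) : ℤ) * (-v) i
        simp only [Pi.neg_apply, mul_neg, add_neg_cancel_right]
      have h := (mem_Icc_iff_ediv ht (hlo i) (hhi i) (z i)).1 (hz i)
      rwa [hzi, hshift] at h
    · rintro ⟨v, hv⟩
      refine ⟨x + pmul (per P) v, fun i => ?_, cover_add_pmul x v⟩
      exact (mem_Icc_iff_ediv ht (hlo i) (hhi i) _).2 (by rw [hshift]; exact hv i)
  intro x y hxy
  rw [key, key, hxy]

/-- ★ **def-R's ENLARGED CUBES ARE UNIONS OF `n`-BLOCKS**: `cubeEnl P s a w` (the `w`-collar of the `s`-cube of index `a` on the fine torus, [III] (2.16)–(2.17)) is a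
union of `n`-blocks of `Setup` (`B14.Eq22Determines.IsBlockUnion`) whenever `Lⁿ ∣ s` in the standing range `n ≤ m + K` — r11's `isBlockUnion_image` on the
deck-saturated box.  At the χ_{k+1}-cubes of (3.2) the side is `L^{k+2}M₂R_{k+1}`, so `□`, `□^∼`, `□^{∼4}` are unions of `(k+1)`-blocks.
[cite: Balaban1988Convergent, (2.1) p.255, (2.16)–(2.17) p.257, (3.2) p.265; Balaban1987RG1, (0.1) p.251] -/
theorem isBlockUnion_cubeEnl {n : ℕ} (hn : n ≤ P.m + P.K) {s : ℕ} (hs : P.L ^ n ∣ s) (a : Pt P.d) (w : ℕ) :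
    IsBlockUnion n (cubeEnl P s a w) := by
  have hLn : 0 < P.L ^ n := pow_pos P.L_pos n
  have hN : P.L ^ n ∣ P.sitesPerDir 0 := by
    refine ⟨2 * P.L ^ (P.m + P.K - n), ?_⟩
    unfold Params.sitesPerDir
    rw [Nat.sub_zero, mul_left_comm, ← pow_add, Nat.add_sub_cancel' hn]
  have h := isBlockUnion_image hn (dvd_refl (P.L ^ n)) (preimage_deck (cubeEnl P s a w))
    (isUnionOfCubes_preimage_cubeEnl hLn hs hN a w)
  rwa [image_preimage] at h

end Geometry

/-! ## §2  Every layer of the (2.16) datum `M˙(Q_{k}^{s*}V)` is as regular as `V` near the cube -/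

section Layers

variable (F : T4Family) (N : ℕ) [NeZero N]

/-- ★★ **EVERY LAYER OF THE DATUM `M˙(Q_k^{s*}V)` IS `δ`-SMALL INSIDE A BLOCK UNION ON WHICH `V` IS** (averaging of record): if `V` (scale `k`) is `δ`-small
(`0 < δ`) on the scale-`k` plaquettes inside `Y^{(k)}`, `Y` a union of `k`-blocks, then every layer `M^i(Q_k^{s*}V)`, `i ≤ k`, is `δ`-small on the scale-`i`
plaquettes inside `Y^{(i)}` — `M^i(Q_k^{s*}V) = Q^{s*}_{k−i}V` (section property, `T3DescentFibreTower.expMeanLogSU_E_one` + dag-n12-c's `iter_blockAvg_qsstarGIter0_add`)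
and a pull-back's plaquette variable is `1` or one of `V` inside `Y^{(k)}` (dag-n12-c's `plaqSmallOn_qsstarGIter_of_isBlockUnion`); [15] p. 279 (11) verbatim.
[cite: Balaban1985Variational, (7) p.278, (11) p.279; Balaban1988Convergent, (2.11) p.256, (2.16) p.257; BalabanImbrieJaffe1985, (4.5.3) p.312] -/
theorem plaqSmallOn_layers_avgFamily_qsstarGIter0 {K k : ℕ} (hk : k ≤ (F.P K).m + (F.P K).K) {Y : Set (Site (F.P K) 0)}
    (hY : IsBlockUnion k Y) {δ : ℝ} (hδ : 0 < δ) {V : GaugeField (F.P K) k (SU N)}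
    (hV : PlaqSmallOn (plaqsInside (pts k Y)) δ V) {i : ℕ} (hi : i ≤ k) :
    PlaqSmallOn (plaqsInside (pts i Y)) δ (avgFamily (avOfRecord F N K) (qsstarGIter0 k V) i) := by
  haveI : Nonempty (Fin N) := ⟨⟨0, Nat.pos_of_ne_zero (NeZero.ne N)⟩⟩
  obtain ⟨n, rfl⟩ := Nat.exists_eq_add_of_le hi
  have hd : 2 ≤ (F.P K).d := by rw [T4Family.P_d]; norm_num
  show PlaqSmallOn _ _ (Averaging.iter (fun j => BlockAveraging.blockAvg ExpMeanLog.expMeanLogSU) i (qsstarGIter0 (i + n) V))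
  rw [B15Prop1DatumSmall7AtZSequence.iter_blockAvg_qsstarGIter0_add ExpMeanLog.expMeanLogSU
    T3DescentFibreTower.expMeanLogSU_E_one (by omega) V]
  exact B15Prop1DatumSmall7AtZSequence.plaqSmallOn_qsstarGIter_of_isBlockUnion hd hk hY subset_rfl hδ hV

variable (ν : Stage7Numerics) (p : B12.RunParams) (g : ℕ → ℝ)

/-- `L^{k+1}` divides the side `L^{k+2}M₂R_{k+1}` of the χ_{k+1}-cubes of (3.2). [cite: Balaban1988Convergent, (3.2) p.265, (2.17) p.257 (bookkeeping)] -/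
theorem pow_succ_dvd_sideχ (k : ℕ) : (F.P p.K).L ^ (k + 1) ∣ sideχ F ν p g k :=
  ⟨(F.P p.K).L * ν.M₂ * RkOfRecord (F.P p.K).L ν.r (g (k + 1)), by unfold sideχ cubeSide; ring⟩

/-- The χ_{k+1}-cube collars `□_c^{∼w}` are unions of `(k+1)`-blocks (`k + 1 ≤ m + K`). [cite: Balaban1988Convergent, (3.2) p.265, (2.16) p.257] -/
theorem isBlockUnion_cubeEnl_sideχ {k : ℕ} (hk : k + 1 ≤ (F.P p.K).m + (F.P p.K).K) (c : Iχ F ν p g k) (w : ℕ) :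
    IsBlockUnion (k + 1) (cubeEnl (F.P p.K) (sideχ F ν p g k) c w) :=
  isBlockUnion_cubeEnl hk (pow_succ_dvd_sideχ F ν p g k) _ w

/-- ★★ **(T♮)'s TOP-LAYER PREMISE IS PRINT'S (7) AT EVERY LAYER OF `𝐁_{k+1}(□^{∼4})`**: if `V'` is `δ`-small (`0 < δ`) on the scale-`(k+1)` plaquettes sourced in
`□_c^{∼4}`, then EVERY layer `i ≤ k+1` of the (2.16) datum of record `M˙(Q_{k+1}^{s*}V') = avgFamily avOfRecord (qsstarGIter0 (k+1) V')` is `δ`-small on the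
scale-`i` plaquettes inside `(□_c^{∼4})^{(i)}` ⊇ print's (7) range (§3): the lower layers of the local determining set carry NEAR data (pull-backs of `V'` over
`□^{∼4}`), not the far field — the CAUTION of HOME `N20-S1-RESIDUAL.md` §(T♮) (g10) is void. [cite: Balaban1985Variational, (7) p.278, (11) p.279; Balaban1988Convergent, (2.16)–(2.17) p.257, (3.2) p.265] -/
theorem plaqSmallOn_layers_datum_of_top {k : ℕ} (hk : k + 1 ≤ (F.P p.K).m + (F.P p.K).K) (c : Iχ F ν p g k) {δ : ℝ} (hδ : 0 < δ)
    {V' : GaugeField (F.P p.K) (k + 1) (SU N)}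
    (hV' : ∀ p' : Plaq (F.P p.K) (k + 1), embIter (k + 1) p'.src ∈ cubeEnl (F.P p.K) (sideχ F ν p g k) c 4 →
      dist1 (GaugeField.plaqHol V' p') < δ) {i : ℕ} (hi : i ≤ k + 1) :
    PlaqSmallOn (plaqsInside (pts i (cubeEnl (F.P p.K) (sideχ F ν p g k) c 4))) δ
      (avgFamily (avOfRecord F N p.K) (qsstarGIter0 (k + 1) V') i) :=
  plaqSmallOn_layers_avgFamily_qsstarGIter0 F N hk (isBlockUnion_cubeEnl_sideχ F ν p g hk c 4) hδ
    (fun p' hp' => hV' p' hp'.1) hi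

end Layers

/-! ## §3  The same in NODE 00's (7)-grammar `Sect2.DataSmall7PTop` along the local maximal sequence `{Ω_n(□^{∼4})}` -/

section Node00Grammar

variable (F : T4Family) (N : ℕ) [NeZero N] (ν : Stage7Numerics) (p : B12.RunParams) (g : ℕ → ℝ)

/-- ★★ **PRINT'S (7) IN NODE 00's GRAMMAR FOR THE (2.16) DATUM OF RECORD, ANY TOP DOMAIN INSIDE `□^{∼4}`**: along the local maximal sequence
`{Ω_n(□_c^{∼4})} = maxDomT ν.M₁ (□_c^{∼4})` of (2.13) (so that `𝐁_{k+1}(□^{∼4}) = genSet (maxDomT ν.M₁ □^{∼4}) (k+1)`, r11's `Bj`), for every top domain `Ω₀`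
whose level-`0` (7) range lies inside `□^{∼4}`, the datum `M˙(Q_{k+1}^{s*}V')` satisfies NODE 00's `Sect2.DataSmall7PTop avOfRecord Ω Ω₀ (k+1) (fun _ ↦ δ)` as soon
as `V'` is `δ`-small on the scale-`(k+1)` plaquettes sourced in `□^{∼4}` (dag-n12-c's `dataSmall7PTop_avgFamily_qsstarGIter0` at `Y := □^{∼4}`, §2; levels `≥ 1`
inside `□^{∼4}` by dag-n12-c's `printedPlaqs_maxDomT_subset_plaqsInside` — print's `M₁ ≥ 2`, torus divisibility `L^{k+1}M₁ ∣ 2L^{m+K}`). [cite: Balaban1985Variational, (7) p.278 L20–33, (11) p.279; Balaban1988Convergent, (2.13) pp.256–257, (2.16) p.257] -/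
theorem dataSmall7PTop_avgFamily_qsstarGIter0_cubeEnl (hM₁ : 2 ≤ ν.M₁) {k : ℕ} (hk : k + 1 ≤ (F.P p.K).m + (F.P p.K).K)
    (hdiv : side (F.P p.K).L ν.M₁ (k + 1) ∣ (F.P p.K).sitesPerDir 0) (c : Iχ F ν p g k) {Ω₀ : Set (Site (F.P p.K) 0)}
    (hΩ₀ : Sect2.printedPlaqsTop (maxDomT ν.M₁ (cubeEnl (F.P p.K) (sideχ F ν p g k) c 4)) Ω₀ (k + 1) ⊆
      plaqsInside (cubeEnl (F.P p.K) (sideχ F ν p g k) c 4))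
    {δ : ℝ} (hδ : 0 < δ) {V' : GaugeField (F.P p.K) (k + 1) (SU N)}
    (hV' : ∀ p' : Plaq (F.P p.K) (k + 1), embIter (k + 1) p'.src ∈ cubeEnl (F.P p.K) (sideχ F ν p g k) c 4 →
      dist1 (GaugeField.plaqHol V' p') < δ) :
    Sect2.DataSmall7PTop (avOfRecord F N p.K) (maxDomT ν.M₁ (cubeEnl (F.P p.K) (sideχ F ν p g k) c 4)) Ω₀ (k + 1) (fun _ => δ)
      (avgFamily (avOfRecord F N p.K) (qsstarGIter0 (k + 1) V')) := by
  haveI : Nonempty (Fin N) := ⟨⟨0, Nat.pos_of_ne_zero (NeZero.ne N)⟩⟩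
  have hd : 2 ≤ (F.P p.K).d := by rw [T4Family.P_d]; norm_num
  exact B15Prop1DatumSmall7AtZSequence.dataSmall7PTop_avgFamily_qsstarGIter0 hd ExpMeanLog.expMeanLogSU
    T3DescentFibreTower.expMeanLogSU_E_one rfl hk _ Ω₀ _ (isBlockUnion_cubeEnl_sideχ F ν p g hk c 4) hΩ₀
    (fun m hm => B15Prop1DatumSmall7AtZSequence.printedPlaqs_maxDomT_subset_plaqsInside hM₁ hdiv (k + 1) (by omega) hm)
    (fun _ _ => hδ) V' (fun _ _ p' hp' => hV' p' hp'.1)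

/-- ★ **… AT NODE 00's SUPPORT OF RECORD** `Ω₀ := suppDomOfRecord F ν K Ω = Ω₁(□^{∼4}) +` one layer of `M₁`-cubes ([III] p. 255; the selector of the K0 facts
`VariationalThm1RegSepCoP7M`): there the level-`0` range lies inside `□^{∼4}` by dag-n12-c's `printedPlaqsTop_maxDomT_subset_plaqsInside`, so NO range letter is left.
[cite: Balaban1985Variational, (7) p.278 L20–33; Balaban1988Convergent, p.255, (2.13) pp.256–257, (2.16) p.257] -/
theorem dataSmall7PTop_avgFamily_qsstarGIter0_cubeEnl_supp (hM₁ : 2 ≤ ν.M₁) {k : ℕ} (hk : k + 1 ≤ (F.P p.K).m + (F.P p.K).K)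
    (hdiv : side (F.P p.K).L ν.M₁ (k + 1) ∣ (F.P p.K).sitesPerDir 0) (c : Iχ F ν p g k)
    {δ : ℝ} (hδ : 0 < δ) {V' : GaugeField (F.P p.K) (k + 1) (SU N)}
    (hV' : ∀ p' : Plaq (F.P p.K) (k + 1), embIter (k + 1) p'.src ∈ cubeEnl (F.P p.K) (sideχ F ν p g k) c 4 →
      dist1 (GaugeField.plaqHol V' p') < δ) :
    Sect2.DataSmall7PTop (avOfRecord F N p.K) (maxDomT ν.M₁ (cubeEnl (F.P p.K) (sideχ F ν p g k) c 4))
      (suppDomOfRecord F ν p.K (maxDomT ν.M₁ (cubeEnl (F.P p.K) (sideχ F ν p g k) c 4))) (k + 1) (fun _ => δ)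
      (avgFamily (avOfRecord F N p.K) (qsstarGIter0 (k + 1) V')) :=
  dataSmall7PTop_avgFamily_qsstarGIter0_cubeEnl F N ν p g hM₁ hk hdiv c
    (B15Prop1DatumSmall7AtZSequence.printedPlaqsTop_maxDomT_subset_plaqsInside (le_trans (by norm_num) hM₁) hdiv (by omega) (k + 1))
    hδ hV'

end Node00Grammar

/-! ## §4  (T♭) ⇒ (T♮): the instance and the named Props modulo (W♮) + (T♭) -/

section Instance

variable (F : T4Family) (N : ℕ) [NeZero N] (ν : Stage7Numerics) (M : ℕ) (p : B12.RunParams) (g : ℕ → ℝ) (A₁ : ℝ)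

/-- ★★ **(T♭) ⇒ (T♮)**: a per-cube regularity statement for the (2.16) problems of record with print's ALL-LAYER (7) premise (`ε″_j`-smallness of every member
`M^i(Q_{j+1}^{s*}V')`, `i ≤ j+1`, inside `(□_c^{∼4})^{(i)}`) implies the same statement with (T♮)'s TOP-LAYER premise, for any positive `ε″_j` and any conclusion
thresholds `θ_j`, at levels `j < K` (§2).  (T♭) is the WEAKER hypothesis — [15] Thm 1 (8) for the χ-problem with its premise RESTRICTED to print's range. [cite: Balaban1985Variational, (7) p.278, Thm 1 (8) p.279, (11) p.279; Balaban1988Convergent, (2.16)–(2.17) p.257] -/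
theorem hThm1_of_allLayers (J : Finset ℕ) (hJ : ∀ j ∈ J, j < p.K) {ε'' θ : ℕ → ℝ} (hε'' : ∀ j ∈ J, 0 < ε'' j)
    (hThm1' : ∀ j ∈ J, ∀ (c : Iχ F ν p g j) (V' : GaugeField (F.P p.K) (j + 1) (SU N)) (U₀ : GaugeField (F.P p.K) 0 (SU N)),
      IsMinimizer (avOfRecord F N p.K) {U | PlaqSmall (ν.εreg * (F.P p.K).eta (j + 1) ^ 2) U}
          (Bj ν.M₁ (cubeEnl (F.P p.K) (sideχ F ν p g j) c 4) (j + 1)) (avgFamily (avOfRecord F N p.K) (qsstarGIter0 (j + 1) V')) U₀ →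
      (∀ i, i ≤ j + 1 → PlaqSmallOn (plaqsInside (pts i (cubeEnl (F.P p.K) (sideχ F ν p g j) c 4))) (ε'' j)
        (avgFamily (avOfRecord F N p.K) (qsstarGIter0 (j + 1) V') i)) →
      PlaqSmallOn (plaqInside (cubeEnl (F.P p.K) (sideχ F ν p g j) c 1)) (θ j) U₀) :
    ∀ j ∈ J, ∀ (c : Iχ F ν p g j) (V' : GaugeField (F.P p.K) (j + 1) (SU N)) (U₀ : GaugeField (F.P p.K) 0 (SU N)),
      IsMinimizer (avOfRecord F N p.K) {U | PlaqSmall (ν.εreg * (F.P p.K).eta (j + 1) ^ 2) U}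
          (Bj ν.M₁ (cubeEnl (F.P p.K) (sideχ F ν p g j) c 4) (j + 1)) (avgFamily (avOfRecord F N p.K) (qsstarGIter0 (j + 1) V')) U₀ →
      (∀ p' : Plaq (F.P p.K) (j + 1), embIter (j + 1) p'.src ∈ cubeEnl (F.P p.K) (sideχ F ν p g j) c 4 →
        dist1 (GaugeField.plaqHol V' p') < ε'' j) →
      PlaqSmallOn (plaqInside (cubeEnl (F.P p.K) (sideχ F ν p g j) c 1)) (θ j) U₀ := by
  intro j hj c V' U₀ hmin htop
  have hjK : j + 1 ≤ (F.P p.K).m + (F.P p.K).K := by have := hJ j hj; rw [T4Family.P_K]; omega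
  exact hThm1' j hj c V' U₀ hmin fun i hi => plaqSmallOn_layers_datum_of_top F N ν p g hjK c (hε'' j hj) htop hi

/-- A2 for (T♭): in the degenerate regime `εreg ≤ ε_{k+1}` every minimiser over def-R's class is already `ε_{k+1}η²`-small everywhere, so (T♭) holds at every cube
with its premise UNUSED (module 49 §3's witness for (T♮), verbatim). [cite: Balaban1988Convergent, (2.12) p.256, (2.17) p.257 (bookkeeping)] -/
theorem hThm1'_of_le_epsOfRecord {k : ℕ} (hle : ν.εreg ≤ epsOfRecord ν g (k + 1)) (c : Iχ F ν p g k) (ε'' : ℝ) :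
    ∀ (V' : GaugeField (F.P p.K) (k + 1) (SU N)) (U₀ : GaugeField (F.P p.K) 0 (SU N)),
      IsMinimizer (avOfRecord F N p.K) {U | PlaqSmall (ν.εreg * (F.P p.K).eta (k + 1) ^ 2) U}
          (Bj ν.M₁ (cubeEnl (F.P p.K) (sideχ F ν p g k) c 4) (k + 1)) (avgFamily (avOfRecord F N p.K) (qsstarGIter0 (k + 1) V')) U₀ →
      (∀ i, i ≤ k + 1 → PlaqSmallOn (plaqsInside (pts i (cubeEnl (F.P p.K) (sideχ F ν p g k) c 4))) ε''
        (avgFamily (avOfRecord F N p.K) (qsstarGIter0 (k + 1) V') i)) →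
      PlaqSmallOn (plaqInside (cubeEnl (F.P p.K) (sideχ F ν p g k) c 1)) (epsOfRecord ν g (k + 1) * (F.P p.K).eta (k + 1) ^ 2) U₀ :=
  fun _ _ hmin _ q _ => lt_of_lt_of_le (hmin.1 q) (mul_le_mul_of_nonneg_right hle (sq_nonneg _))

/-- Below `g⋆` the premise threshold `ε(g)∕B` is positive (`0 < g < 1`, `0 < A₀`, `0 < B`). [cite: Balaban1988Convergent, (2.4) p.255 (bookkeeping)] -/
theorem epsOfRecord_div_pos (hA0 : 0 < ν.A₀) {B : ℝ} (hB : 0 < B) {k : ℕ} (hg0 : 0 < g k) (hg1 : g k < 1) :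
    0 < epsOfRecord ν g k / B := by
  have hlog : 0 < Real.log ((g k) ^ 2)⁻¹ := Real.log_pos ((one_lt_inv₀ (by positivity)).2 (by nlinarith))
  have hε : 0 < epsOfRecord ν g k := by
    unfold epsOfRecord p0Profile
    exact mul_pos hg0 (mul_pos hA0 (pow_pos hlog _))
  exact div_pos hε hB

open Classical in
/-- ★★★ **THE INSTANCE AT THE RECORD FOR ARBITRARY PINNED FAMILIES BELOW `g⋆`, MODULO (W♮) + (T♭)** — module 53's `sum_admS_integral_le_rec_pinnedLevels_of_le_gstar` with its
hypothesis (T♮) REPLACED by the weaker (T♭) = «[15] Thm 1 (8) for the (2.16) χ-problems of record, premise = print's (7) on EVERY layer of `𝐁_{j+1}(□^{∼4})` inside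
`□^{∼4}` at threshold `ε(g_{j+1})∕B`, conclusion = `ε(g_{j+1})η²`-smallness on `{p ⊂ □^∼}`»; everything else byte for byte module 53's.
[cite: Balaban1989LargeFieldII, (1.79)–(1.80) pp.383–384; Balaban1987RG1, Thm 2 p.259; Balaban1985Variational, (7) p.278, Thm 1 (8) p.279, (11) p.279] -/
theorem sum_admS_integral_le_rec_pinnedLevels_of_le_gstar_allLayers {ρ₀ : cfgOfRecord F N p.K 0 → ℝ}
    (hρ : (bddMeas (cfgOfRecord F N p.K 0)).Gd ρ₀) (h0 : ∀ U, 0 ≤ ρ₀ U) (hM₂ : 0 < ν.M₂)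
    (J : Finset ℕ) (hJ : ∀ j ∈ J, j < p.K)
    (D : (j : ℕ) → Finset (Iχ F ν p g j)) {B : ℝ} (hB : 0 < B)
    (hA0 : 0 < ν.A₀) (hp0 : 1 ≤ ν.p₀)
    (hThm1' : ∀ j ∈ J, ∀ (c : Iχ F ν p g j) (V' : GaugeField (F.P p.K) (j + 1) (SU N)) (U₀ : GaugeField (F.P p.K) 0 (SU N)),
      IsMinimizer (avOfRecord F N p.K) {U | PlaqSmall (ν.εreg * (F.P p.K).eta (j + 1) ^ 2) U}
          (Bj ν.M₁ (cubeEnl (F.P p.K) (sideχ F ν p g j) c 4) (j + 1)) (avgFamily (avOfRecord F N p.K) (qsstarGIter0 (j + 1) V')) U₀ →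
      (∀ i, i ≤ j + 1 → PlaqSmallOn (plaqsInside (pts i (cubeEnl (F.P p.K) (sideχ F ν p g j) c 4))) (epsOfRecord ν g (j + 1) / B)
        (avgFamily (avOfRecord F N p.K) (qsstarGIter0 (j + 1) V') i)) →
      PlaqSmallOn (plaqInside (cubeEnl (F.P p.K) (sideχ F ν p g j) c 1)) (epsOfRecord ν g (j + 1) * (F.P p.K).eta (j + 1) ^ 2) U₀)
    {α C a₀ δ : ℝ} (hα : 0 < α)
    (hguard : (((((F.P p.K).d + 2) * (F.P p.K).L : ℕ) : ℝ) ^ 2 / 4) * Real.sqrt (2 * (Fintype.card (Fin N) : ℝ) * α) < deltaSU (Fin N))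
    (hC : 0 ≤ C) (hδ : 0 < δ)
    (hδa : δ * ((2 * (Fintype.card (Fin N) : ℝ) * (((F.P p.K).L : ℝ) ^ 2 + 6 * ((((F.P p.K).d + 2) * (F.P p.K).L : ℕ) : ℝ) ^ 2) ^ 2 +
        2 / α) * (((2 * (((F.P p.K).d + 3) * (F.P p.K).L + 2) + 1) ^ (F.P p.K).d * (F.P p.K).d ^ 2 : ℕ) : ℝ)) ≤ a₀)
    (hgstar : ∀ j ∈ J, 0 < g (j + 1) ∧ g (j + 1) ≤ Real.exp (-(max 1
      ((4 * (Fintype.card (Fin N) : ℝ) * B ^ 2 *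
          (C * ((2 * (Fintype.card (Fin N) : ℝ) * (((F.P p.K).L : ℝ) ^ 2 + 6 * ((((F.P p.K).d + 2) * (F.P p.K).L : ℕ) : ℝ) ^ 2) ^ 2 + 2 / α) *
              (((2 * (((F.P p.K).d + 3) * (F.P p.K).L + 2) + 1) ^ (F.P p.K).d * (F.P p.K).d ^ 2 : ℕ) : ℝ)) *
              (((2 * (((F.P p.K).d + 3) * (F.P p.K).L + 2) + 1) ^ (F.P p.K).d * (F.P p.K).d ^ 2 : ℕ) : ℝ) +
            Real.log (((F.P p.K).d ^ 2 * (9 * (F.P p.K).L * (F.P p.K).L * ν.M₂) ^ (F.P p.K).d : ℕ) : ℝ) / δ) +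
        4 * (Fintype.card (Fin N) : ℝ) * B ^ 2 * ((ν.r * (F.P p.K).d : ℕ) : ℝ) / δ) / ν.A₀ ^ 2)) / 2))
    (K' : ℕ) (E : (j : ℕ) → (Fin j → LabelPat F ν p g) → Finset (LbOfRecord F ν p g j)) (hE : ∀ j ∈ J, ∀ h t, t ∈ E j h → D j ⊆ t.1)
    (hW : ∀ j ∈ J, j < K' → ∀ h : Fin j → LabelPat F ν p g,
      h ∈ admS (labelTowerOfRecord F N ν M p g A₁ (zeta316OfRecord F N ν M A₁)) (labelPattern F ν p g E) j →
      ∀ a : ℝ, 0 ≤ a → a ≤ a₀ → ∀ X : Finset (Plaq (F.P p.K) j),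
        (∀ q ∈ X, ∃ c ∈ cubes32 F ν M p g j (seqOfHist F ν M p g j h),
          ∃ p' ∈ (Finset.univ.filter fun q : Plaq (F.P p.K) (j + 1) => embIter (j + 1) q.src ∈ cubeEnl (F.P p.K) (sideχ F ν p g j) c 4),
            q ∈ boxRegion (emb p'.src) (((F.P p.K).d + 3) * (F.P p.K).L + 2)) →
        ∫ U, Real.exp (a * ((g (j + 1)) ^ 2)⁻¹ * ∑ q ∈ X, (1 - reTr (GaugeField.plaqHol U q))) *
            (labelTowerOfRecord F N ν M p g A₁ (zeta316OfRecord F N ν M A₁)).eterm ρ₀ j h U ∂(lawOfRecord F N p.K j) ≤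
          Real.exp (C * a * X.card) * ∫ U, (labelTowerOfRecord F N ν M p g A₁ (zeta316OfRecord F N ν M A₁)).eterm ρ₀ j h U ∂(lawOfRecord F N p.K j)) :
    ∑ h ∈ admS (labelTowerOfRecord F N ν M p g A₁ (zeta316OfRecord F N ν M A₁)) (labelPattern F ν p g E) K',
        ∫ x, (labelTowerOfRecord F N ν M p g A₁ (zeta316OfRecord F N ν M A₁)).eterm ρ₀ K' h x ∂(lawOfRecord F N p.K K') ≤
      Real.exp (-(δ * (C * ((2 * (Fintype.card (Fin N) : ℝ) * (((F.P p.K).L : ℝ) ^ 2 + 6 * ((((F.P p.K).d + 2) * (F.P p.K).L : ℕ) : ℝ) ^ 2) ^ 2 +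
              2 / α) * (((2 * (((F.P p.K).d + 3) * (F.P p.K).L + 2) + 1) ^ (F.P p.K).d * (F.P p.K).d ^ 2 : ℕ) : ℝ)) *
              (((2 * (((F.P p.K).d + 3) * (F.P p.K).L + 2) + 1) ^ (F.P p.K).d * (F.P p.K).d ^ 2 : ℕ) : ℝ))) / (39 : ℝ) ^ (F.P p.K).d *
          ∑ j ∈ (Finset.range K').filter (· ∈ J), ((D j).card : ℝ)) *
        ∫ U, ρ₀ U ∂(fieldMeasure (F.P p.K) 0 (SU N)) := by
  have hg1 : ∀ j ∈ J, g (j + 1) < 1 := fun j hj =>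
    lt_of_le_of_lt (hgstar j hj).2 (by
      rw [Real.exp_lt_one_iff, neg_div, neg_lt_zero]; exact div_pos (lt_max_iff.2 (Or.inl one_pos)) two_pos)
  exact sum_admS_integral_le_rec_pinnedLevels_of_le_gstar F N ν M p g A₁ hρ h0 hM₂ J hJ D hB hA0 hp0
    (hThm1_of_allLayers F N ν p g J hJ (fun j hj => epsOfRecord_div_pos ν g hA0 hB (hgstar j hj).1 (hg1 j hj)) hThm1')
    hα hguard hC hδ hδa hgstar K' E hE hW

open Classical in
/-- ★★★ **`PointwiseExtraction ∧ LocCondStability` FOR ARBITRARY PINNED FAMILIES BELOW `g⋆`, MODULO (W♮) + (T♭)** — module 54's `halves_of_le_gstar_of_any` with (T♮) REPLACED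
by the weaker (T♭) (print's all-layer (7) premise); everything else byte for byte module 54's: a 39^d-dense skeleton `D′ ⊆ D` with pairwise disjoint canonical regions,
module 41's windowed indicator carriers at threshold `ε(g_{j+1})∕B`, stability exponents `log (rate j) ≤ −δ·C·A·M_h²·#D′_j`.
[cite: Balaban1989LargeFieldI, (0.3)–(0.5) pp.176–177; Balaban1989LargeFieldII, (1.79)–(1.80) pp.383–384; Balaban1985Variational, (7) p.278, Thm 1 (8) p.279, (11) p.279] -/
theorem halves_of_le_gstar_of_any_allLayers {ρ₀ : cfgOfRecord F N p.K 0 → ℝ}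
    (hρ : (bddMeas (cfgOfRecord F N p.K 0)).Gd ρ₀) (h0 : ∀ U, 0 ≤ ρ₀ U) (hM₂ : 0 < ν.M₂)
    (J : Finset ℕ) (hJ : ∀ j ∈ J, j < p.K)
    (D : (j : ℕ) → Finset (Iχ F ν p g j)) {B : ℝ} (hB : 0 < B)
    (hA0 : 0 < ν.A₀) (hp0 : 1 ≤ ν.p₀)
    (hThm1' : ∀ j ∈ J, ∀ (c : Iχ F ν p g j) (V' : GaugeField (F.P p.K) (j + 1) (SU N)) (U₀ : GaugeField (F.P p.K) 0 (SU N)),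
      IsMinimizer (avOfRecord F N p.K) {U | PlaqSmall (ν.εreg * (F.P p.K).eta (j + 1) ^ 2) U}
          (Bj ν.M₁ (cubeEnl (F.P p.K) (sideχ F ν p g j) c 4) (j + 1)) (avgFamily (avOfRecord F N p.K) (qsstarGIter0 (j + 1) V')) U₀ →
      (∀ i, i ≤ j + 1 → PlaqSmallOn (plaqsInside (pts i (cubeEnl (F.P p.K) (sideχ F ν p g j) c 4))) (epsOfRecord ν g (j + 1) / B)
        (avgFamily (avOfRecord F N p.K) (qsstarGIter0 (j + 1) V') i)) →
      PlaqSmallOn (plaqInside (cubeEnl (F.P p.K) (sideχ F ν p g j) c 1)) (epsOfRecord ν g (j + 1) * (F.P p.K).eta (j + 1) ^ 2) U₀)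
    {α C a₀ δ : ℝ} (hα : 0 < α)
    (hguard : (((((F.P p.K).d + 2) * (F.P p.K).L : ℕ) : ℝ) ^ 2 / 4) * Real.sqrt (2 * (Fintype.card (Fin N) : ℝ) * α) < deltaSU (Fin N))
    (hC : 0 ≤ C) (hδ : 0 < δ)
    (hδa : δ * ((2 * (Fintype.card (Fin N) : ℝ) * (((F.P p.K).L : ℝ) ^ 2 + 6 * ((((F.P p.K).d + 2) * (F.P p.K).L : ℕ) : ℝ) ^ 2) ^ 2 +
        2 / α) * (((2 * (((F.P p.K).d + 3) * (F.P p.K).L + 2) + 1) ^ (F.P p.K).d * (F.P p.K).d ^ 2 : ℕ) : ℝ)) ≤ a₀)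
    (hgstar : ∀ j ∈ J, 0 < g (j + 1) ∧ g (j + 1) ≤ Real.exp (-(max 1
      ((4 * (Fintype.card (Fin N) : ℝ) * B ^ 2 *
          (C * ((2 * (Fintype.card (Fin N) : ℝ) * (((F.P p.K).L : ℝ) ^ 2 + 6 * ((((F.P p.K).d + 2) * (F.P p.K).L : ℕ) : ℝ) ^ 2) ^ 2 + 2 / α) *
              (((2 * (((F.P p.K).d + 3) * (F.P p.K).L + 2) + 1) ^ (F.P p.K).d * (F.P p.K).d ^ 2 : ℕ) : ℝ)) *
              (((2 * (((F.P p.K).d + 3) * (F.P p.K).L + 2) + 1) ^ (F.P p.K).d * (F.P p.K).d ^ 2 : ℕ) : ℝ) +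
            Real.log (((F.P p.K).d ^ 2 * (9 * (F.P p.K).L * (F.P p.K).L * ν.M₂) ^ (F.P p.K).d : ℕ) : ℝ) / δ) +
        4 * (Fintype.card (Fin N) : ℝ) * B ^ 2 * ((ν.r * (F.P p.K).d : ℕ) : ℝ) / δ) / ν.A₀ ^ 2)) / 2))
    (K' : ℕ) (E : (j : ℕ) → (Fin j → LabelPat F ν p g) → Finset (LbOfRecord F ν p g j)) (hE : ∀ j ∈ J, ∀ h t, t ∈ E j h → D j ⊆ t.1)
    (hW : ∀ j ∈ J, j < K' → ∀ h : Fin j → LabelPat F ν p g,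
      h ∈ admS (labelTowerOfRecord F N ν M p g A₁ (zeta316OfRecord F N ν M A₁)) (labelPattern F ν p g E) j →
      ∀ a : ℝ, 0 ≤ a → a ≤ a₀ → ∀ X : Finset (Plaq (F.P p.K) j),
        (∀ q ∈ X, ∃ c ∈ cubes32 F ν M p g j (seqOfHist F ν M p g j h),
          ∃ p' ∈ (Finset.univ.filter fun q : Plaq (F.P p.K) (j + 1) => embIter (j + 1) q.src ∈ cubeEnl (F.P p.K) (sideχ F ν p g j) c 4),
            q ∈ boxRegion (emb p'.src) (((F.P p.K).d + 3) * (F.P p.K).L + 2)) →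
        ∫ U, Real.exp (a * ((g (j + 1)) ^ 2)⁻¹ * ∑ q ∈ X, (1 - reTr (GaugeField.plaqHol U q))) *
            (labelTowerOfRecord F N ν M p g A₁ (zeta316OfRecord F N ν M A₁)).eterm ρ₀ j h U ∂(lawOfRecord F N p.K j) ≤
          Real.exp (C * a * X.card) * ∫ U, (labelTowerOfRecord F N ν M p g A₁ (zeta316OfRecord F N ν M A₁)).eterm ρ₀ j h U ∂(lawOfRecord F N p.K j)) :
    ∃ D' : (j : ℕ) → Finset (Iχ F ν p g j), (∀ j, D' j ⊆ D j) ∧ (∀ j, (D j).card ≤ 39 ^ (F.P p.K).d * (D' j).card) ∧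
      (∀ j, ∀ c₁ ∈ D' j, ∀ c₂ ∈ D' j, c₁ ≠ c₂ → Disjoint
        (Finset.univ.filter fun q : Plaq (F.P p.K) (j + 1) => embIter (j + 1) q.src ∈ cubeEnl (F.P p.K) (sideχ F ν p g j) c₁ 4)
        (Finset.univ.filter fun q : Plaq (F.P p.K) (j + 1) => embIter (j + 1) q.src ∈ cubeEnl (F.P p.K) (sideχ F ν p g j) c₂ 4)) ∧
      PointwiseExtraction (labelTowerOfRecord F N ν M p g A₁ (zeta316OfRecord F N ν M A₁)) (labelPattern F ν p g E) K'
          (labelChi F N ν M p g A₁ (zeta316OfRecord F N ν M A₁))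
          (fun j h U => if j ∈ J then (if D' j ⊆ cubes32 F ν M p g j (seqOfHist F ν M p g j h) then
            Set.indicator {U : cfgOfRecord F N p.K j | ∀ c ∈ D' j, ∃ p' ∈ (Finset.univ.filter fun q : Plaq (F.P p.K) (j + 1) => embIter (j + 1) q.src ∈ cubeEnl (F.P p.K) (sideχ F ν p g j) c 4),
              epsOfRecord ν g (j + 1) / B ≤ dist1 (GaugeField.plaqHol ((avOfRecord F N p.K j).avg U) p')} (fun _ => (1 : ℝ)) U else 0) else 1)
          (fun _ _ => 0) ∧
      LocCondStability (labelTowerOfRecord F N ν M p g A₁ (zeta316OfRecord F N ν M A₁)) (labelPattern F ν p g E) K' (lawOfRecord F N p.K) ρ₀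
          (fun j h U => if j ∈ J then (if D' j ⊆ cubes32 F ν M p g j (seqOfHist F ν M p g j h) then
            Set.indicator {U : cfgOfRecord F N p.K j | ∀ c ∈ D' j, ∃ p' ∈ (Finset.univ.filter fun q : Plaq (F.P p.K) (j + 1) => embIter (j + 1) q.src ∈ cubeEnl (F.P p.K) (sideχ F ν p g j) c 4),
              epsOfRecord ν g (j + 1) / B ≤ dist1 (GaugeField.plaqHol ((avOfRecord F N p.K j).avg U) p')} (fun _ => (1 : ℝ)) U else 0) else 1)
          (fun j _ => if j ∈ J then Real.log (((((F.P p.K).d ^ 2 * (9 * ((F.P p.K).L * ν.M₂ * RkOfRecord (F.P p.K).L ν.r (g (j + 1)))) ^ (F.P p.K).d : ℕ) : ℝ) * Real.exp (C * ((2 * (Fintype.card (Fin N) : ℝ) * (((F.P p.K).L : ℝ) ^ 2 + 6 * ((((F.P p.K).d + 2) * (F.P p.K).L : ℕ) : ℝ) ^ 2) ^ 2 + 2 / α) * (((2 * (((F.P p.K).d + 3) * (F.P p.K).L + 2) + 1) ^ (F.P p.K).d * (F.P p.K).d ^ 2 : ℕ) : ℝ)) * (((2 * (((F.P p.K).d +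 3) * (F.P p.K).L + 2) + 1) ^ (F.P p.K).d * (F.P p.K).d ^ 2 : ℕ) : ℝ) * δ - δ * ((g (j + 1)) ^ 2)⁻¹ * ((epsOfRecord ν g (j + 1) / B) ^ 2 / (2 * (Fintype.card (Fin N) : ℝ))))) ^ (D' j).card) else 0) ∧
      (∀ j ∈ J, Real.log (((((F.P p.K).d ^ 2 * (9 * ((F.P p.K).L * ν.M₂ * RkOfRecord (F.P p.K).L ν.r (g (j + 1)))) ^ (F.P p.K).d : ℕ) : ℝ) * Real.exp (C * ((2 * (Fintype.card (Fin N) : ℝ) * (((F.P p.K).L : ℝ) ^ 2 + 6 * ((((F.P p.K).d + 2) * (F.P p.K).L : ℕ) : ℝ) ^ 2) ^ 2 + 2 / α) * (((2 * (((F.P p.K).d + 3) * (F.P p.K).L + 2) + 1) ^ (F.P p.K).d * (F.P p.K).d ^ 2 : ℕ) : ℝ)) * (((2 * (((F.P p.K).d + 3) * (F.P p.K).L + 2) + 1) ^ (F.P p.K).d * (F.P p.K).d ^ 2 : ℕ) : ℝ) * δ - δ * ((g (j + 1)) ^ 2)⁻¹ * ((epsOfRecord ν g (j + 1) / B) ^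 2 / (2 * (Fintype.card (Fin N) : ℝ))))) ^ (D' j).card) ≤
        -(δ * (C * ((2 * (Fintype.card (Fin N) : ℝ) * (((F.P p.K).L : ℝ) ^ 2 + 6 * ((((F.P p.K).d + 2) * (F.P p.K).L : ℕ) : ℝ) ^ 2) ^ 2 + 2 / α) * (((2 * (((F.P p.K).d + 3) * (F.P p.K).L + 2) + 1) ^ (F.P p.K).d * (F.P p.K).d ^ 2 : ℕ) : ℝ)) * (((2 * (((F.P p.K).d + 3) * (F.P p.K).L + 2) + 1) ^ (F.P p.K).d * (F.P p.K).d ^ 2 : ℕ) : ℝ))) * (D' j).card) := by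
  have hg1 : ∀ j ∈ J, g (j + 1) < 1 := fun j hj =>
    lt_of_le_of_lt (hgstar j hj).2 (by
      rw [Real.exp_lt_one_iff, neg_div, neg_lt_zero]; exact div_pos (lt_max_iff.2 (Or.inl one_pos)) two_pos)
  exact halves_of_le_gstar_of_any F N ν M p g A₁ hρ h0 hM₂ J hJ D hB hA0 hp0
    (hThm1_of_allLayers F N ν p g J hJ (fun j hj => epsOfRecord_div_pos ν g hA0 hB (hgstar j hj).1 (hg1 j hj)) hThm1')
    hα hguard hC hδ hδa hgstar K' E hE hW

end Instance

end Summit.QuantumFields.YangMills.BalabanUVNodes.N20LCSDatumAllLayers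

end
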